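import Summits.QuantumFields.YangMills.Theorems.BalabanUVNodesN08AtRecord13CoPH
import Summits.QuantumFields.YangMills.Theorems.BalabanUVNodesN08AtRecord13LaneFamily

/-!
# BalabanUVNodes ∕ N08 THROUGH THE RE-BOUND [B10] LAYER OF THE ₁₃ H CARRIER STACK — v1.7 `CoPH` EDITION OF RECORD 13 (director-ym LINE №183 RULING H1ʰ ∕ №186 (α) ∕ №187; FINDING №9 = node00-def-T LOCATED-9 «the v1.6 residual 𝐓-weight slot `Stage13RParams.Zr p`
is run-indexed but HISTORY-BLIND, while print's ζ(Ω^c_{k+1}) ([Balaban1988Convergent] p.267 L15–20, (3.23) p.270) reads the term's whole history (Ω_j, Λ_j)»): def-T FILE 27 `Node00/Record13CoPH`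
(p537939 ✓ 2668afee4a5b: `structure Stage13HParams extends Stage13RParams` + history-indexed fields `Zh p n Ω Λ : TkResidualW F N (FluctV N) p.K` (level-indexed, read AT THE WHOLE HISTORY `θ.zhAt p s = θ.Zh p n s.Ω s.Λ`)
and `Phih` (history-indexed smearing functions of the residual §2 data, C2 fold №187), guard `ZhUnity`, weights `WtOfRecord₁₃H θ p s`, provisos `Stage13HParams.Provisos₁₃CoPH` (Core rows +
`zhLaws ∕ zhLocal`), view `toStage5₁₃CoPH`, datum `datumOfRecord₁₃CoPH`, record `IsRecordOfRecord₁₃CCoPH` + faces; THE DOOR `Stage13HParams.ofHistoryBlind θ := ⟨θ, fun p _ _ _ => θ.Zr p, fun p _ _ _ => (θ.Rz p.K).phi⟩`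
+ `rfl` ∕ `Iff.rfl` faces + dot-forms `Stage13RParams.ZrUnity.ofHistoryBlind ∕ ….Provisos₁₃(Sep)CoPR.ofHistoryBlind`) and FILE 28T `Node00/Record13SepCoPH` (p539169 ✓ df011462f50f: `Provisos₁₃SepCoPH`, `datumOfRecord₁₃SepCoPH`,
`IsRecordOfRecord₁₃CSepCoPH` + `.toCoPH`); dag-n10-d's H carrier leaves `Node00/Record13CarriersCoPH` (p539476 ✓ 944d848ee41f: §0 THE H-PIN ALGEBRA `Stage13HParams.onBase ∕ rebindX ∕ pin<G>` (structure updates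
keeping `Zh ∕ Phih`), `toStage5₁₃CoPH_rebindX ∕ _pin<G>`, `Provisos₁₃CoPH.rebindX ∕ .pin<G>`, `datumOfRecord₁₃CoPH_rebindX ∕ _pin<G>`, `isRecordOfRecord₁₃CCoPH_rebindX ∕ _pinB10_of_eq`, `exists_world_…_rebindX`,
`guard_rebindX_iff`, H views `view₁₃CoPHB10YZW ∕ …B8B10YZW` + `_eq` + `_leaves`, §6 door-commute faces) and `…/Record13CarriersSepCoPH` (p540513 ✓ 81f7bc100561: `Provisos₁₃SepCoPH.pin<G>`, `datumOfRecord₁₃SepCoPH_pin<G>`,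
`isRecordOfRecord₁₃CSepCoPH_pinB10_of_eq`).  Token map T₇ (plan IMPACT-183 + AMENDMENT (α), def-T KEYMAP v1.7, dag-lead WORDS): «the v1.6 names with `CoPR ↦ CoPH`, binders `Stage13RParams ↦ Stage13HParams`, `ZrUnity ↦ ZhUnity`, rows `zrLaws ∕ zrLocal ↦ zhLaws ∕ zhLocal`, `WtOfRecord₁₃R θ p ↦ (s ↦ WtOfRecord₁₃H θ p s)`».
# THIS FILE = the T₇ image of `BalabanUVNodesN08AtRecord13CoPRLaneFamily` (p534121): N08 AT A v1.7 STAGE-13 RECORD (`IsRecordOfRecord₁₃CCoPH`) WHOSE [B10] LAYER IS RE-BOUND (dag-n10-d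
# `Record13CarriersCoPH`: `Stage13HParams.rebindX`, `toStage5₁₃CoPH_rebindX`, `isRecordOfRecord₁₃CCoPH_rebindX_of_eq`, `exists_world_isRecordOfRecord₁₃CCoPH_rebindX`, `datumOfRecord₁₃CoPH_rebindX`,
# `guard_rebindX_iff`) TO AN EXHIBITED FAMILY OF [B10] TOWER RUNS carrying Thm 1-compact ∧ Thm 2 — instance: dag-n08-d's CONSTRUCTED d = 3 LANE FAMILY from «cluster-expansion DATA ∧
# three in-edge faces» (Track A, DAG node N08 [Balaban1985UV3] CMP **102** (1985) 255, Thm 1 p. 257 (compact reading) + Thm 2 p. 272; R134 fan-out seat `pub-ymgap-dag-n08-c` g17, strategy s2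
«knit at the record of record», trigger (t31) = FINDING №9 ∕ №174 (3) «pens port their OWN files»; 2026-08-27)

WHY THIS FILE.  p534121 binds its worlds over `(θ.rebindX …).toStage5₁₃CoPR` with `θ : Stage13RParams`; at v1.7 the re-binding must be dag-n10-d's H-level `Stage13HParams.rebindX`
(keeping `Zh ∕ Phih`) and the view `toStage5₁₃CoPH`, so §2 ∕ §2b ∕ §3 are re-typed here as IMAGES under T₇ over n10-d's H re-binding faces.  CITED from p495845 ∕ p498647, not
re-declared (θ-free or `Stage5Params`-generic; fed `θ.toStage13Params` where they read the base): `N08AtRecord13LaneFamily.b10Compact_withTowerRuns10_iff ∕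
upOfRecord₅C_rebindX_withTowerRuns10_b10_iff(_b10Compact) ∕ b10Compact_withTowerRuns10_of_isEmpty` (the VACUITY CERTIFICATE stands: an EMPTY re-bound family carries the compact node
outright, so content enters only through the EXHIBITED family), `upOfRecord₅C_rebindX_towerRuns_pin3_b10_iff`, `b10Compact_laneFamily_of_data_faces₃`, `nonempty_laneIndex`.  No
witness-line theorem in this file (no `Zr ∕ Zh ∕ Phih ∕ hZ` binder); departures (ii′)∕(iii) of the sibling modules do not arise; (i) as there.

WHAT IS PROVED (kernel bookkeeping BY NAME; 0 `def`, 0 `sorry`).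
* §2 at a ₁₃CCoPH record whose [B10] layer is re-bound to a tower-run family `T` (generic, displayed as DATA `hT : ∀ P, b10Compact ((Xc P).withTowerRuns10 T)`): exact leaf ∕
  exact reading ∕ POINTED CLOSER at a world bound over `(θ.rebindX …).toStage5₁₃CoPH` (`b10_leaf_iff_ ∕ b10_main_iff_ ∕ b10_main_of_up_rebindX_towerRuns`); ∃-CURRENCY
  `exists_world₁₃CCoPH_rebindX_towerRuns_b10_main` (n10-d's `exists_world_isRecordOfRecord₁₃CCoPH_rebindX`); N08's conjunct shape `exists_guarded_record₁₃CCoPH_b10_main_of_towerRuns`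
  (guard `ZhUnity ∧ SlotsNondegenerate₁₃` carried to the re-bound parameter by n10-d's `Stage13HParams.guard_rebindX_iff`);
* §2b the pointed closer ∕ exact leaf over the lane-keyed four-layer H word `((((θ.rebindX …).pinY Y₀).pinZ Z₀).pinW W₀).toStage5₁₃CoPH` (n10-d's four `toStage5₁₃CoPH_<pin>` `rfl`s);
* §3 THE LANE INSTANCE `T :=` dag-n08-d's constructed family on `ScalesLE θ.L ((min γ_N08 1)²)` from «DATA ∧ three faces»:
  `exists_world₁₃CCoPH_laneFamily_b10_main_of_data_faces₃`, `exists_guarded_record₁₃CCoPH_laneFamily_b10_main_of_data_faces₃`, ★ `…_of_inhabited13CoPH` (+ `_two` at `N = 2`).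
HONEST FRAMING — PLEASE READ.  The re-bound [B10] layer here is THE LANE'S FAMILY (dag-n08-d's d = 3 small-field programme, given its external inputs), NOT print's run family
of record (`runsB10OfRecord`, the `pinB10` layer) — hence NOT the slot `Node00.PrintedUV3V N θ.L` and NOT a re-pointing of S1; whether N08's COUNT may be read there is the chair's
species word (seam E6′, R451 ∕ R454).  Count-neutral re-keying of a LANDED storey to the re-issued record (new file; p534121 stays as the ⁶ sibling).  The DATA schema `RunDataRows`
(the [B10] §§2–3 cluster expansion at the lane's run objects — class II of the n08-b census = the object gap in data form), the in-edge hypotheses where displayed, the provisos,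
admissibility, the guard and every window inequality are DISPLAYED hypotheses; nothing of Bałaban's asserted; a re-key is not progress; K0 ∕ K1 neither proved nor assumed; N08 NOT
discharged; one finite four-torus per run at fixed `ε`, the lane's d = 3 tori inside the record; nothing continuum ∕ ℝ⁴ ∕ OS ∕ mass gap ∕ Clay.  0 `sorry`, 0 `def`, standard axioms.
Sources: [Balaban1985UV3] Thm 1 p.257, Thm 2 p.272, (1)–(5) p.256, p.256 L15–18; [Balaban1989LargeFieldII] Thm 1 + (0.1) pp.355–356; [Balaban1988Convergent] p.244, (1.11) p.248,
(2.18) p.257, p.267, (3.16)–(3.23) pp.268–270; [Balaban1989LargeFieldI] (0.2) p.176, (0.3)–(0.4) p.176.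
-/

noncomputable section

namespace Summit.QuantumFields.YangMills.BalabanUVNodes.N08AtRecord13CoPHLaneFamily

open MeasureTheory
open scoped BigOperators Matrix.Norms.L2Operator
open Literature.MathematicalPhysics.QuantumFieldTheory.Balaban1983to89
open Literature.MathematicalPhysics.QuantumFieldTheory.Balaban1983to89.B10
open Literature.MathematicalPhysics.QuantumFieldTheory.Balaban1983to89.B10SectCExpansion (TermSizes)
open Literature.MathematicalPhysics.QuantumFieldTheory.Balaban1985CMP102
open Literature.MathematicalPhysics.QuantumFieldTheory.Balaban1985CMP102.Setting
open Literature.MathematicalPhysics.QuantumFieldTheory.Balaban1985CMP102.Theorems (Family runs)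
open Literature.MathematicalPhysics.QuantumFieldTheory.Balaban1983to89.T4Continuum (T4Family FiniteEpsData)
open Literature.MathematicalPhysics.QuantumFieldTheory.Balaban1983to89.DagBinding (leavesP WorldP PrintedCarriersR PrintedCarriers9X PrintedCarriers11 PrintedCarriers15)
open Literature.MathematicalPhysics.QuantumFieldTheory.Balaban1983to89.DagDischarged (b10Compact)
open Literature.MathematicalPhysics.QuantumFieldTheory.Balaban1983to89.Node00
open Summit.QuantumFields.Balaban3D.Carriers
open Summit.QuantumFields.Balaban3D.Proofs.Inputs
open Summit.QuantumFields.Balaban3D.Proofs.Primitives (AlphaConsts)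
open Summit.QuantumFields.Balaban3D.Proofs.GroupModelLieC (lieC)
open Summit.QuantumFields.Balaban3D.Proofs.UVStability3DInputs
open Summit.QuantumFields.Balaban3D.Proofs.FamilyLE (ScalesLE)
open Summit.QuantumFields.YangMills.Theorems.BalabanUVNodesN08AlphaClassI
open Summit.QuantumFields.YangMills.Theorems.BalabanUVNodesN08AlphaLoop28
open Summit.QuantumFields.YangMills.Theorems.BalabanUVNodesN08AlphaThreeFaces
open Summit.QuantumFields.YangMills.BalabanUVNodes.N08AtStage5View (b10_main_of_up_eq b10_leaf_iff_of_up_eq b10_main_iff_of_up_eq b10Face_pinY b10Face_pinZ b10Face_pinW)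
open Summit.QuantumFields.YangMills.BalabanUVNodes.N08AtRecord13CoPH

variable {F : T4Family} {N : ℕ} [NeZero N]

/-! ## §2 N08 AT A ₁₃CCoPH RECORD WHOSE [B10] LAYER IS RE-BOUND TO A TOWER-RUN FAMILY `T` CARRYING Thm 1-compact ∧ Thm 2 (generic `T`, displayed as DATA) -/

section Generic
variable (θ : Stage13HParams F N) (Xc : B12.RunParams → PrintedCarriersR) {I : Type} (T : I → B10.TowerRun) {w : WorldP}

/-- **EXACT LEAF at a world bound over the re-bound Stage-13 view**: `b10 ⟺ b10Compact ((Xc P).withTowerRuns10 T)`. [cite: Balaban1985UV3, Thm 1 p.257 (compact reading) + Thm 2 p.272] -/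
theorem b10_leaf_iff_of_up_rebindX_towerRuns
    (hup : ∀ P, w.up P = upOfRecord₅C F N ((θ.rebindX F N fun P => (Xc P).withTowerRuns10 T).toStage5₁₃CoPH F N) P) (P : B12.RunParams) :
    (leavesP w P).b10 ↔ b10Compact ((Xc P).withTowerRuns10 T).toPrintedCarriers :=
  b10_leaf_iff_of_up_eq (hup P) (N08AtRecord13LaneFamily.upOfRecord₅C_rebindX_withTowerRuns10_b10_iff_b10Compact _ Xc T P)

/-- **EXACT READING OF N08 there**: `Dag.B10_main ⟺ (in-edge leaves ⟹ b10Compact ((Xc P).withTowerRuns10 T))`. [cite: Balaban1985UV3, Thm 1 p.257 (compact reading) + Thm 2 p.272] -/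
theorem b10_main_iff_of_up_rebindX_towerRuns
    (hup : ∀ P, w.up P = upOfRecord₅C F N ((θ.rebindX F N fun P => (Xc P).withTowerRuns10 T).toStage5₁₃CoPH F N) P) (P : B12.RunParams) :
    Dag.B10_main (leavesP w P) ↔
      ((leavesP w P).b5 → (leavesP w P).b6 → (leavesP w P).b7 → (leavesP w P).b8 → (leavesP w P).b9 → (leavesP w P).b11 →
        b10Compact ((Xc P).withTowerRuns10 T).toPrintedCarriers) :=
  b10_main_iff_of_up_eq (hup P) (N08AtRecord13LaneFamily.upOfRecord₅C_rebindX_withTowerRuns10_b10_iff_b10Compact _ Xc T P)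

/-- **POINTED CLOSER**: at a world bound over the re-bound Stage-13 view, N08 at every run ⟸ the compact node of the re-bound carriers at every run (in-edges unused;
this seat's generic `N08AtStage5View.b10_main_of_up_eq`). [cite: Balaban1985UV3, Thm 1 p.257 (compact reading) + Thm 2 p.272] -/
theorem b10_main_of_up_rebindX_towerRuns
    (hup : ∀ P, w.up P = upOfRecord₅C F N ((θ.rebindX F N fun P => (Xc P).withTowerRuns10 T).toStage5₁₃CoPH F N) P)
    (hT : ∀ P : B12.RunParams, b10Compact ((Xc P).withTowerRuns10 T).toPrintedCarriers) (P : B12.RunParams) :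
    Dag.B10_main (leavesP w P) :=
  b10_main_of_up_eq (hup P) (N08AtRecord13LaneFamily.upOfRecord₅C_rebindX_withTowerRuns10_b10_iff_b10Compact _ Xc T P) (hT P)

variable {θ}

/-- **∃-CURRENCY**: at the datum of ANY admissible Stage-13 tuple with provisos, a world (any window `γw`, block size `θ.L`) that IS a ₁₃CCoPH record of `datumOfRecord₁₃CoPH F N θ h`,
bound over the Stage-13 view with the [B10] layer re-bound to `P ↦ (Xc P).withTowerRuns10 T`, carrying N08 at every run — from the compact node of those carriers
(dag-n10-d's `exists_world_isRecordOfRecord₁₃CCoPH_rebindX` + the pointed closer). [cite: Balaban1985UV3, Thm 1 p.257 (compact reading) + Thm 2 p.272; Balaban1989LargeFieldII, Thm 1 + (0.1) pp.355–356 (the record's world; bookkeeping)] -/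
theorem exists_world₁₃CCoPH_rebindX_towerRuns_b10_main (h : θ.Provisos₁₃CoPH F N) (hθ : θ.Admissible F N) {γw : ℝ} (hγw : 0 < γw ∧ γw ≤ θ.γ)
    (hT : ∀ P : B12.RunParams, b10Compact ((Xc P).withTowerRuns10 T).toPrintedCarriers) :
    ∃ w : WorldP, IsRecordOfRecord₁₃CCoPH F N (datumOfRecord₁₃CoPH F N θ h) w ∧ w.γ = γw ∧ w.L = (θ.L : ℝ) ∧
      (∀ P, w.up P = upOfRecord₅C F N ((θ.rebindX F N fun P => (Xc P).withTowerRuns10 T).toStage5₁₃CoPH F N) P) ∧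
      ∀ P : B12.RunParams, Dag.B10_main (leavesP w P) := by
  obtain ⟨w, hR, hγ, hL, hup⟩ := exists_world_isRecordOfRecord₁₃CCoPH_rebindX F N θ h hθ (fun P => (Xc P).withTowerRuns10 T) hγw
  exact ⟨w, hR, hγ, hL, hup, b10_main_of_up_rebindX_towerRuns θ Xc T hup hT⟩

/-- **N08's CONJUNCT SHAPE OF A CORE-KEYED `NodesAtSomeRecord13`, WITNESSED AT `θ` ITSELF** (guard and admissibility read at `θ`; the presenting re-bound parameter is inside the ∃
of `IsRecordOfRecord₁₃CCoPH`): from provisos, admissibility, the guard, and the compact node of the re-bound carriers at every run. [cite: Balaban1985UV3, Thm 1 p.257 (compact reading) + Thm 2 p.272; Balaban1989LargeFieldII, Thm 1 + (0.1) pp.355–356; Balaban1988Convergent, (3.16)–(3.22) pp.268–269 (the guard; bookkeeping)] -/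
theorem exists_guarded_record₁₃CCoPH_b10_main_of_towerRuns (h : θ.Provisos₁₃CoPH F N) (hθ : θ.Admissible F N) (hG : θ.ZhUnity F N ∧ θ.SlotsNondegenerate₁₃ F N)
    (hT : ∀ P : B12.RunParams, b10Compact ((Xc P).withTowerRuns10 T).toPrintedCarriers) :
    ∃ (θ' : Stage13HParams F N) (h' : θ'.Provisos₁₃CoPH F N) (w : WorldP), (θ'.ZhUnity F N ∧ θ'.SlotsNondegenerate₁₃ F N) ∧ θ'.Admissible F N ∧
      IsRecordOfRecord₁₃CCoPH F N (datumOfRecord₁₃CoPH F N θ' h') w ∧ ∀ P : B12.RunParams, Dag.B10_main (leavesP w P) := by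
  obtain ⟨w, hR, -, -, -, hN⟩ := exists_world₁₃CCoPH_rebindX_towerRuns_b10_main Xc T h hθ ⟨hθ.toStage9.gamma_pos, le_rfl⟩ hT
  exact ⟨θ, h, w, hG, hθ, hR, hN⟩

end Generic

/-! ## §2b THE SAME LEAF THROUGH THE THREE OUTER PINS — over `(((σ.rebindX …).pinY Y₀).pinZ Z₀).pinW W₀` (the word a four-pin pointed Stage-13 assembler binds over, with the
lane family in the [B10] slot instead of print's; this seat's `N08AtStage5View.b10Face_pinY ∕ _pinZ ∕ _pinW` BY NAME) -/

section Pin3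
variable (Xc : B12.RunParams → PrintedCarriersR) {I : Type} (T : I → B10.TowerRun) (Y₀ : PrintedCarriers9X) (Z₀ : PrintedCarriers11)
  (W₀ : B12.RunParams → PrintedCarriers15)

/-- **POINTED CLOSER over the lane-keyed four-layer Stage-13 word** `((((θ.rebindX …).pinY Y₀).pinZ Z₀).pinW W₀).toStage5₁₃CoPH` (= the Stage-5 word at `σ := θ.toStage5₁₃CoPH`,
dag-n10-d's `toStage5₁₃CoPH_rebindX ∕ _pinY ∕ _pinZ ∕ _pinW`, `rfl`): N08 at every run ⟸ the compact node of the re-bound carriers at every run — the `h10leaf` line of a four-pin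
pointed assembler that takes N08 from the (α) programme. [cite: Balaban1985UV3, Thm 1 p.257 (compact reading) + Thm 2 p.272] -/
theorem b10_main_of_up_rebindX_towerRuns_pin3 (θ : Stage13HParams F N) {w : WorldP}
    (hup : ∀ P, w.up P = upOfRecord₅C F N
      (((((θ.rebindX F N fun P => (Xc P).withTowerRuns10 T).pinY F N Y₀).pinZ F N Z₀).pinW F N W₀).toStage5₁₃CoPH F N) P)
    (hT : ∀ P : B12.RunParams, b10Compact ((Xc P).withTowerRuns10 T).toPrintedCarriers) (P : B12.RunParams) :
    Dag.B10_main (leavesP w P) :=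
  b10_main_of_up_eq ((hup P).trans (by
      rw [Stage13HParams.toStage5₁₃CoPH_pinW, Stage13HParams.toStage5₁₃CoPH_pinZ, Stage13HParams.toStage5₁₃CoPH_pinY, Stage13HParams.toStage5₁₃CoPH_rebindX]))
    (N08AtRecord13LaneFamily.upOfRecord₅C_rebindX_towerRuns_pin3_b10_iff Xc T Y₀ Z₀ W₀ (θ.toStage5₁₃CoPH F N) P) (hT P)

/-- … and the exact leaf there. [cite: Balaban1985UV3, Thm 1 p.257 (compact reading) + Thm 2 p.272] -/
theorem b10_leaf_iff_of_up_rebindX_towerRuns_pin3 (θ : Stage13HParams F N) {w : WorldP}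
    (hup : ∀ P, w.up P = upOfRecord₅C F N
      (((((θ.rebindX F N fun P => (Xc P).withTowerRuns10 T).pinY F N Y₀).pinZ F N Z₀).pinW F N W₀).toStage5₁₃CoPH F N) P) (P : B12.RunParams) :
    (leavesP w P).b10 ↔ b10Compact ((Xc P).withTowerRuns10 T).toPrintedCarriers :=
  b10_leaf_iff_of_up_eq ((hup P).trans (by
      rw [Stage13HParams.toStage5₁₃CoPH_pinW, Stage13HParams.toStage5₁₃CoPH_pinZ, Stage13HParams.toStage5₁₃CoPH_pinY, Stage13HParams.toStage5₁₃CoPH_rebindX]))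
    (N08AtRecord13LaneFamily.upOfRecord₅C_rebindX_towerRuns_pin3_b10_iff Xc T Y₀ Z₀ W₀ (θ.toStage5₁₃CoPH F N) P)

end Pin3

/-! ## §3 THE LANE INSTANCE: dag-n08-d's CONSTRUCTED FAMILY `S ↦ towerOf 𝔠.lane (X S) (𝔖 S)` ON THE N08 WINDOW `ScalesLE θ.L ((min γ_N08 1)²)` AT THE RECORD'S BLOCK SIZE,
from «cluster-expansion DATA schema ∧ three in-edge faces» BY NAME (`b10Compact_constructedLE_of_faces₃_family`) -/

section Lane
variable {G : Type} [GaugeGroup G] [MeasurableSpace G] [HaarData G] {𝔊 : GroupModel G}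

/-- **A ₁₃CCoPH RECORD OF `datumOfRecord₁₃CoPH F N θ h` BOUND OVER THE LANE-RE-BOUND STAGE-13 VIEW, CARRYING N08 AT EVERY RUN, from «DATA ∧ three faces»** (any window `γw`, block
size `θ.L`).  The world at which a pointed Stage-13 assembler wanting N08 from the (α) programme — rather than from the slot of record — presents the other nodes.
[cite: Balaban1985UV3, Thm 1 p.257 (compact reading) + Thm 2 p.272; Balaban1989LargeFieldII, Thm 1 + (0.1) pp.355–356 (bookkeeping)] -/
theorem exists_world₁₃CCoPH_laneFamily_b10_main_of_data_faces₃ (θ : Stage13HParams F N) (h : θ.Provisos₁₃CoPH F N) (hθ : θ.Admissible F N)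
    {𝔠 : AlphaConsts θ.L 𝔊.N} {X : ∀ S : Scales θ.L, ExternalInputs S G}
    {𝔖 : ∀ (S : Scales θ.L) (k : ℕ), StepSeries S G ↥(lieC 𝔊) (nblkOf S 𝔠.lane.carrier k) k} {𝔄 : ∀ S : Scales θ.L, AlphaData 𝔊 𝔠 (X S) (𝔖 S)}
    (coef : ∀ (S : Scales θ.L) (k : ℕ), Hist S.P (k + 1) → GaugeField S.P (k + 1) G → (j : ℕ) → TermSizes (oldGeom S.P k j))
    (hD : ∀ S : Scales θ.L, S.g ^ 2 * S.ε₀ ≤ (min (gammaN08 𝔠) 1) ^ 2 → RunDataRows 𝔊 𝔠 (X S) (𝔖 S) (𝔄 S) (sizesOf 𝔊 𝔠 (X S) (coef S)))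
    (hF : ∀ S : Scales θ.L, S.g ^ 2 * S.ε₀ ≤ (min (gammaN08 𝔠) 1) ^ 2 → InEdgeFaces₃ 𝔊 (regMin 𝔠) (X S))
    {γw : ℝ} (hγw : 0 < γw ∧ γw ≤ θ.γ) :
    ∃ w : WorldP, IsRecordOfRecord₁₃CCoPH F N (datumOfRecord₁₃CoPH F N θ h) w ∧ w.γ = γw ∧ w.L = (θ.L : ℝ) ∧
      (∀ P, w.up P = upOfRecord₅C F N ((θ.rebindX F N fun P => (θ.res.X P).withTowerRuns10
        fun S : ScalesLE θ.L ((min (gammaN08 𝔠) 1) ^ 2) => towerOf 𝔠.lane (X S.1) (𝔖 S.1)).toStage5₁₃CoPH F N) P) ∧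
      ∀ P : B12.RunParams, Dag.B10_main (leavesP w P) :=
  exists_world₁₃CCoPH_rebindX_towerRuns_b10_main _ _ h hθ hγw (N08AtRecord13LaneFamily.b10Compact_laneFamily_of_data_faces₃ θ.toStage13Params coef hD hF)

/-- **N08's CONJUNCT SHAPE OF `NodesAtSomeRecord13`, WITNESSED AT `θ`, from «DATA ∧ three faces» at block size `θ.L`** (plus `θ`'s provisos, admissibility and guard).
[cite: Balaban1985UV3, Thm 1 p.257 (compact reading) + Thm 2 p.272; Balaban1989LargeFieldII, Thm 1 + (0.1) pp.355–356; Balaban1988Convergent, (3.16)–(3.22) pp.268–269 (bookkeeping)] -/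
theorem exists_guarded_record₁₃CCoPH_laneFamily_b10_main_of_data_faces₃ (θ : Stage13HParams F N) (h : θ.Provisos₁₃CoPH F N) (hθ : θ.Admissible F N)
    (hG : θ.ZhUnity F N ∧ θ.SlotsNondegenerate₁₃ F N) {𝔠 : AlphaConsts θ.L 𝔊.N} {X : ∀ S : Scales θ.L, ExternalInputs S G}
    {𝔖 : ∀ (S : Scales θ.L) (k : ℕ), StepSeries S G ↥(lieC 𝔊) (nblkOf S 𝔠.lane.carrier k) k} {𝔄 : ∀ S : Scales θ.L, AlphaData 𝔊 𝔠 (X S) (𝔖 S)}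
    (coef : ∀ (S : Scales θ.L) (k : ℕ), Hist S.P (k + 1) → GaugeField S.P (k + 1) G → (j : ℕ) → TermSizes (oldGeom S.P k j))
    (hD : ∀ S : Scales θ.L, S.g ^ 2 * S.ε₀ ≤ (min (gammaN08 𝔠) 1) ^ 2 → RunDataRows 𝔊 𝔠 (X S) (𝔖 S) (𝔄 S) (sizesOf 𝔊 𝔠 (X S) (coef S)))
    (hF : ∀ S : Scales θ.L, S.g ^ 2 * S.ε₀ ≤ (min (gammaN08 𝔠) 1) ^ 2 → InEdgeFaces₃ 𝔊 (regMin 𝔠) (X S)) :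
    ∃ (θ' : Stage13HParams F N) (h' : θ'.Provisos₁₃CoPH F N) (w : WorldP), (θ'.ZhUnity F N ∧ θ'.SlotsNondegenerate₁₃ F N) ∧ θ'.Admissible F N ∧
      IsRecordOfRecord₁₃CCoPH F N (datumOfRecord₁₃CoPH F N θ' h') w ∧ ∀ P : B12.RunParams, Dag.B10_main (leavesP w P) :=
  exists_guarded_record₁₃CCoPH_b10_main_of_towerRuns _ _ h hθ hG (N08AtRecord13LaneFamily.b10Compact_laneFamily_of_data_faces₃ θ.toStage13Params coef hD hF)

/-- **★ «A CORE-KEYED INHABITATION ⟹ N08's CONJUNCT OF A CORE-KEYED STAGE-13 NODES-∃» THROUGH THE LANE, generic `N`**: from `∃ θ, Provisos₁₃CoPH ∧ (ZhUnity ∧ SlotsNondegenerate₁₃) ∧ Admissible`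
at `F` (HYPOTHESIS `hI`) and, AT EVERY ODD BLOCK SIZE `L > 1`, lane objects `(𝔠, X, 𝔖, 𝔄, coef)` carrying the DATA schema and the three in-edge faces on the N08 window
(HYPOTHESIS `hlane` — the (α) programme's displayed inputs, in place of the slot socket `∀ L, Odd L → 1 < L → PrintedUV3V N L` of `N08AtRecord13CoPH` §2).  NOT the stub, NOT a
discharge; the [B10] layer is the lane's, not print's (module docstring). [cite: Balaban1985UV3, Thm 1 p.257 (compact reading) + Thm 2 p.272 + p.256 L15–18; Balaban1989LargeFieldII, Thm 1 + (0.1) pp.355–356 (bookkeeping)] -/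
theorem exists_guarded_record₁₃CCoPH_laneFamily_b10_main_of_inhabited13CoPH
    (hI : ∃ θ : Stage13HParams F N, θ.Provisos₁₃CoPH F N ∧ (θ.ZhUnity F N ∧ θ.SlotsNondegenerate₁₃ F N) ∧ θ.Admissible F N)
    (hlane : ∀ L : ℕ, Odd L → 1 < L →
      ∃ (𝔠 : AlphaConsts L 𝔊.N) (X : ∀ S : Scales L, ExternalInputs S G)
        (𝔖 : ∀ (S : Scales L) (k : ℕ), StepSeries S G ↥(lieC 𝔊) (nblkOf S 𝔠.lane.carrier k) k) (𝔄 : ∀ S : Scales L, AlphaData 𝔊 𝔠 (X S) (𝔖 S))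
        (coef : ∀ (S : Scales L) (k : ℕ), Hist S.P (k + 1) → GaugeField S.P (k + 1) G → (j : ℕ) → TermSizes (oldGeom S.P k j)),
        (∀ S : Scales L, S.g ^ 2 * S.ε₀ ≤ (min (gammaN08 𝔠) 1) ^ 2 → RunDataRows 𝔊 𝔠 (X S) (𝔖 S) (𝔄 S) (sizesOf 𝔊 𝔠 (X S) (coef S))) ∧
        (∀ S : Scales L, S.g ^ 2 * S.ε₀ ≤ (min (gammaN08 𝔠) 1) ^ 2 → InEdgeFaces₃ 𝔊 (regMin 𝔠) (X S))) :
    ∃ (θ : Stage13HParams F N) (h : θ.Provisos₁₃CoPH F N) (w : WorldP), (θ.ZhUnity F N ∧ θ.SlotsNondegenerate₁₃ F N) ∧ θ.Admissible F N ∧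
      IsRecordOfRecord₁₃CCoPH F N (datumOfRecord₁₃CoPH F N θ h) w ∧ ∀ P : B12.RunParams, Dag.B10_main (leavesP w P) := by
  obtain ⟨θ, h, hG, hθ⟩ := hI
  obtain ⟨𝔠, X, 𝔖, 𝔄, coef, hD, hF⟩ := hlane θ.L θ.hL.1 θ.hL.2
  exact exists_guarded_record₁₃CCoPH_laneFamily_b10_main_of_data_faces₃ θ h hθ hG (𝔄 := 𝔄) coef hD hF

/-- **★ THE SAME AT THE GROUP OF RECORD `N = 2`**, hypothesis `hI` = the Core-keyed inhabitation text (the rev-16 K0‴ body under `Provisos₁₃ ↦ Provisos₁₃CoPH`).  Intended lane group: `G := SU(2)`. [cite: Balaban1985UV3, Thm 1 p.257 (compact reading) + Thm 2 p.272; Balaban1989LargeFieldII, Thm 1 + (0.1) pp.355–356 (bookkeeping)] -/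
theorem exists_guarded_record₁₃CCoPH_laneFamily_b10_main_of_inhabited13CoPH_two (F : T4Family)
    (hI : ∃ θ : Stage13HParams F 2, θ.Provisos₁₃CoPH F 2 ∧ (θ.ZhUnity F 2 ∧ θ.SlotsNondegenerate₁₃ F 2) ∧ θ.Admissible F 2)
    (hlane : ∀ L : ℕ, Odd L → 1 < L →
      ∃ (𝔠 : AlphaConsts L 𝔊.N) (X : ∀ S : Scales L, ExternalInputs S G)
        (𝔖 : ∀ (S : Scales L) (k : ℕ), StepSeries S G ↥(lieC 𝔊) (nblkOf S 𝔠.lane.carrier k) k) (𝔄 : ∀ S : Scales L, AlphaData 𝔊 𝔠 (X S) (𝔖 S))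
        (coef : ∀ (S : Scales L) (k : ℕ), Hist S.P (k + 1) → GaugeField S.P (k + 1) G → (j : ℕ) → TermSizes (oldGeom S.P k j)),
        (∀ S : Scales L, S.g ^ 2 * S.ε₀ ≤ (min (gammaN08 𝔠) 1) ^ 2 → RunDataRows 𝔊 𝔠 (X S) (𝔖 S) (𝔄 S) (sizesOf 𝔊 𝔠 (X S) (coef S))) ∧
        (∀ S : Scales L, S.g ^ 2 * S.ε₀ ≤ (min (gammaN08 𝔠) 1) ^ 2 → InEdgeFaces₃ 𝔊 (regMin 𝔠) (X S))) :
    ∃ (θ : Stage13HParams F 2) (h : θ.Provisos₁₃CoPH F 2) (w : WorldP), (θ.ZhUnity F 2 ∧ θ.SlotsNondegenerate₁₃ F 2) ∧ θ.Admissible F 2 ∧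
      IsRecordOfRecord₁₃CCoPH F 2 (datumOfRecord₁₃CoPH F 2 θ h) w ∧ ∀ P : B12.RunParams, Dag.B10_main (leavesP w P) :=
  exists_guarded_record₁₃CCoPH_laneFamily_b10_main_of_inhabited13CoPH hI hlane

end Lane

end Summit.QuantumFields.YangMills.BalabanUVNodes.N08AtRecord13CoPHLaneFamily

end
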